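import Summits.ABC.ABC.Theses.PadicPrimesYuNinetyOddRadOne
import Summits.ABC.ABC.Theorems.PadicPrimesW80TwoThirdsW80OneModFour
import Summits.ABC.StewartYu.YuNinetyW80KappaTransfer
import HarnessLib

set_option linter.dupNamespace false

/-!
# Route PadicPrimesYuNinetyOddRadOne (rung A1.M2⁻), crux `FinBoundOneModFour` (stmt-ABC-19456)

`Summits/ABC/ABC/Theorems/PadicPrimesYuNinetyOddRadOneFinBoundOneModFour.lean` — cell `abc-stewartyu`
(planner-staged two-liner HOME/plan/routes/closers/PadicPrimesYuNinetyOddRadOneFinBoundBridge.lean, bytes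
by p1-g5, filed by p3-g3).  The `Fin`-indexed `p`-adic bound at `p ≡ 1 (mod 4)` with exponents `(κ, σ, τ, τ₁) = (1, 2, 1, 2)`:
the crux `W80OneModFour` just proved (`padicPrimesW80TwoThirds_w80OneModFour_proof`, p3's ± twist machine)
fed to p3's landed κ-transfer `YuNinetyW80Kappa.finBoundAt_of_residueClass_aux` (`K = 8`,
`L = 2·max(1,|c₅|)`).  Twin of p2's `…FinBoundThreeModFour.lean`.  [folklore] assembly.
-/

namespace Summit.ABC.ABC.Theorems

/-- **Item stmt-ABC-19456 `FinBoundOneModFour`**: for `p ≡ 1 (mod 4)`,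
`ord_p(∏ qᵢ^{eᵢ} − 1) ≤ K·Lⁿ·nⁿ·p²·(∏ log qᵢ)·log B·(log ∏ qᵢ)²`. [folklore] -/
theorem padicPrimesYuNinetyOddRadOne_finBoundOneModFour_proof :
    Summit.ABC.ABC.Theses.PadicPrimesYuNinetyOddRadOne.FinBoundOneModFour := by
  have h0 := padicPrimesW80TwoThirds_w80OneModFour_proof
  unfold Summit.ABC.ABC.Theses.PadicPrimesW80TwoThirds.W80OneModFour at h0
  obtain ⟨c₅, h⟩ := h0
  refine ⟨8, 2 * max 1 |c₅|, by norm_num, ?_, fun p hp hp4 => ?_⟩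
  · have := le_max_left (1 : ℝ) |c₅|; linarith
  · exact Summit.ABC.StewartYu.YuNinetyW80Kappa.finBoundAt_of_residueClass_aux hp (h p hp hp4)
      (le_max_left _ _) (le_max_right _ _)

end Summit.ABC.ABC.Theorems
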